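import Summits.QuantumFields.YangMills.Theorems.BalabanUVNodesN18KingModelCauchy
import Mathlib.MeasureTheory.Measure.Haar.NormedSpace
import Mathlib.MeasureTheory.Integral.Pi
import Mathlib.Analysis.SpecialFunctions.Gaussian.GaussianIntegral

/-!
# BalabanUVNodes ∕ node N18 → N19∕N20 → apex: KING'S GAUSSIAN MODEL WITH A GENUINE SMALL-FIELD ∕ LARGE-FIELD SPLIT — NE7b's `RelWeightBound` PRODUCED (coercivity of `Δ^{(k)}` +
# Gaussian scaling), the two-class `HybridNE7`, and the Cauchy property of the generating functions of the FULL-SPACE dressed partition functions `∫ exp(−½φ·Δ^{(K+1)}φ)·e^{tWφ} dφ`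

Cell `pub-ymgap`, HUMAN RULING D-0062 (Track A), R134 ACCELERATION seat `pub-ymgap-dag-n14-c` re-pointed to **N18-b** (dag-lead REBALANCE №67), generation 6, fourth N18 module; route
`Summits/QuantumFields/YangMills/Theses/BalabanUVNodes.lean` rev 18∕19 (K3⁗ `SpineGivenEndpointR13Sep` = stmt-QuantumFields-20292, `--supports … --as helper`); venue R424 (namespace
`YMDAG.N18.KingModelLargeField`).  ADDITIVE — imports this seat's `…N18KingModelCauchy` (through it `…KingModelDensTorus`, `…KingModelDens`, n19-d's `…N19DensityRoad`, the King files,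
`T4MatchingAssembly`) + Mathlib's Haar scaling ∕ product-integral ∕ Gaussian-integral files; THEOREMS ONLY (0 `def`), modifies nothing.

WHY.  `…N18KingModelCauchy` inhabited the spine's NE7 assembly with the large-field classes EMPTY by fiat.  Here the class decomposition is GENUINE: per run length `K` the field space
`Tor M → ℝ` is cut into the SMALL-FIELD class `|φ(x)| ≤ R_K` and its complement (the bad class), BOTH runs read on both, and NE7b's `RelWeightBound` — the binder N20 consumes BY NAME,
whose `(α)`-instance stands 0∕1 at the record — is PRODUCED for King's Gaussian effective measures from COERCIVITY (`Torus.effLaplacian_coercive`, uniform in the run by `aminL_le_aK`)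
and Gaussian SCALING (`∫ e^{−S/2} = √2^{|Tor M|}·∫ e^{−S}`, Mathlib `Measure.integral_comp_smul`): `∫_{large} e^{−S}e^{tW} ≤ e^{2l₀B}·√2^{|Tor M|}·e^{−γ₀R_K²/4}·∫ e^{−S}e^{tW}`.  A radius
growing like `R_K² ≳ K` makes the weight geometric while the small-field `Core` radius `θ_{K+1}·a·R_K²·|Tor M|/2` stays summable — King's p. 655 trade-off in kernel form.
* §1 [folklore] `dotProduct_mulVec_smul`, `dotProduct_self_eq_sum_sq`, `exp_neg_action_le_prod`, ★ `integrable_exp_neg_action` (Mathlib `Integrable.fintype_prod` ∘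
  `integrable_exp_neg_mul_sq`), `integrable_dressed`, `dressedZ_full_pos`.
* §2 [folklore] `exp_neg_action_le_of_large` (`e^{−S} ≤ e^{−γR²/4}·e^{−S/2}` on the bad class), ★ `integral_exp_neg_quarter_action` (scaling), ★★ **`largeField_weight_le`**.
* §3 [folklore ∘ §1–§2 + `T4MatchingAssembly`] the TWO-CLASS King tower (class index `Bool`, `true` = large, radii `R : ℕ → ℝ`): `sum_bool_eq`, `effLaplacian_coercive_unif`, `gamma0_pos`,
  ★★ **`relWeightBound_kingTwoClass`** (NE7b PRODUCED: `RelWeightBound l₀ univ A B {true} (K ↦ e^{2l₀B}√2^{|Tor M|}e^{−γ₀R_K²/4})` under `< 1` + summable), ★ `core_kingTwoClass` (n19-d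
  `core_dressed_of_vacuumDens` on the small-field class), ★★ `hybridNE7_kingTwoClass`, ★★★ **`cauchy_genFun_kingTwoClass`** (for the FULL-SPACE `Z K t`: NE7 `MatchingModConstants` with
  the summable remainder `hybridDelta vol δ W`, `CauchySeq (K ↦ genFun Z K t)` on `|t| ≤ l₀`, uniform convergence — hypotheses: the model's data, a bounded observable, the two rate
  conditions on `R`; the affine choice `R_K² = R₀² + cK` discharging them is the sequel).

HONEST FRAMING.  King's `A = 0` scalar MODEL, periodic b.c., `m² > 0` (template literature): the large-field estimate is the elementary Gaussian one for the unit-lattice EFFECTIVE measure,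
NOT King's multi-scale T_K(χ) expansion (Thm 3.1) and NOT Bałaban's NE7b for gauge fields (NOT PRINTED; N20's object); count-neutral; N18 ∕ N19 ∕ N20 ∕ N27 NOT discharged; counts
UNMOVED.  Everything is PROVED (0 `sorry`, 0 named facts).  One finite four-torus programme at fixed ε; NOT ℝ⁴, NOT OS, NOT a mass gap, NOT Clay.
-/

noncomputable section

namespace YMDAG.N18.KingModelLargeField

open MeasureTheory Set Filter Finset Real Matrix Topology
open scoped ENNReal BigOperators
open Summit.QuantumFields.BalabanUV.T4Continuum.Spine.NE7 (Core)
open Summit.QuantumFields.YangMills.BalabanUVNodes.N19DensityRoad (core_dressed_of_vacuumDens)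
open YMDAG.N18.KingModelDens (exp_neg_sandwich_of_abs_sub_le kingTheta_nonneg)
open YMDAG.N18.KingModelDensTorus (abs_action_sub_le_torus_of_eq measurable_dotProduct_mulVec dotProduct_effLaplacian_nonneg smallField_eq_Icc volume_smallField_lt_top
  ae_dotProduct_le_smallField dotProduct_self_le_of_abs_le)
open YMDAG.N18.KingModelCauchy (integrand_pos)
open Literature.MathematicalPhysics.QuantumFieldTheory.King1986 (aK thetaK aK_pos aK_le)
open Literature.MathematicalPhysics.QuantumFieldTheory.King1986.Torus (effLaplacian effLaplacian_coercive aminL aminL_pos aminL_le_aK thetaBar thetaK_le)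
open Literature.MathematicalPhysics.QuantumFieldTheory.Balaban1983to89.B5Prop11Plancherel (Tor)
open Literature.MathematicalPhysics.QuantumFieldTheory.Balaban1983to89.QGQInverse (Coercive)
open Literature.MathematicalPhysics.QuantumFieldTheory.Balaban1983to89.T4WeightBudget (RelWeightBound)
open Literature.MathematicalPhysics.QuantumFieldTheory.Balaban1983to89.T4MatchingAssembly (HybridNE7 hybridNE7_noShell)
open Literature.MathematicalPhysics.QuantumFieldTheory.Balaban1983to89.T4CauchySum (MatchingModConstants genFun genFunLim)
open Literature.MathematicalPhysics.QuantumFieldTheory.Balaban1983to89.T4HybridMatching (hybridDelta)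

variable {d : ℕ} (M : Fin d → ℕ) [hM : ∀ μ, NeZero (M μ)]

/-! ## §1 Gaussian integrability of the Boltzmann factor of a coercive quadratic action on the full field space -/
section Integrability

/-- A quadratic action scales quadratically: `(c•φ)·Δ(c•φ) = c²·(φ·Δφ)`. [folklore] -/
theorem dotProduct_mulVec_smul (Δ : Matrix (Tor M) (Tor M) ℝ) (c : ℝ) (φ : Tor M → ℝ) : (c • φ) ⬝ᵥ (Δ *ᵥ (c • φ)) = c ^ 2 * (φ ⬝ᵥ (Δ *ᵥ φ)) := by
  rw [Matrix.mulVec_smul, smul_dotProduct, dotProduct_smul, smul_eq_mul, smul_eq_mul]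
  ring

/-- `φ ⬝ᵥ φ = Σ_x φ(x)²`. [folklore] -/
theorem dotProduct_self_eq_sum_sq (φ : Tor M → ℝ) : φ ⬝ᵥ φ = ∑ x, φ x ^ 2 := by simp [dotProduct, sq]

/-- Coercivity `γ(φ·φ) ≤ φ·Δφ` bounds the Boltzmann factor by a PRODUCT of one-dimensional Gaussians: `e^{−φ·Δφ/2} ≤ Π_x e^{−(γ/2)φ(x)²}`. [folklore] -/
theorem exp_neg_action_le_prod {Δ : Matrix (Tor M) (Tor M) ℝ} {γ : ℝ} (hc : Coercive Δ γ) (φ : Tor M → ℝ) :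
    Real.exp (-(φ ⬝ᵥ (Δ *ᵥ φ) / 2)) ≤ ∏ x, Real.exp (-(γ / 2) * φ x ^ 2) := by
  rw [← Real.exp_sum, ← Finset.mul_sum]
  refine Real.exp_le_exp.2 ?_
  have h := hc φ
  rw [dotProduct_self_eq_sum_sq M φ] at h
  linarith

/-- **THE BOLTZMANN FACTOR OF A COERCIVE QUADRATIC ACTION IS LEBESGUE-INTEGRABLE ON THE FULL FIELD SPACE** [folklore; Mathlib `Integrable.fintype_prod` ∘ `integrable_exp_neg_mul_sq`]. -/
theorem integrable_exp_neg_action {Δ : Matrix (Tor M) (Tor M) ℝ} {γ : ℝ} (hγ : 0 < γ) (hc : Coercive Δ γ) :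
    Integrable (fun φ : Tor M → ℝ => Real.exp (-(φ ⬝ᵥ (Δ *ᵥ φ) / 2))) := by
  have hprod : Integrable (fun φ : Tor M → ℝ => ∏ x, Real.exp (-(γ / 2) * φ x ^ 2)) := by
    rw [MeasureTheory.volume_pi]
    exact Integrable.fintype_prod (f := fun (_ : Tor M) (y : ℝ) => Real.exp (-(γ / 2) * y ^ 2)) fun _ => integrable_exp_neg_mul_sq (by linarith)
  refine hprod.mono' (Real.measurable_exp.comp ((measurable_dotProduct_mulVec M Δ).div_const 2).neg).aestronglyMeasurable (Eventually.of_forall fun φ => ?_)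
  rw [Real.norm_eq_abs, abs_of_pos (Real.exp_pos _)]
  exact exp_neg_action_le_prod M hc φ

/-- … and so is the DRESSED factor `e^{−φ·Δφ/2}·e^{tW(φ)}` for a bounded measurable observable. [folklore] -/
theorem integrable_dressed {Δ : Matrix (Tor M) (Tor M) ℝ} {γ : ℝ} (hγ : 0 < γ) (hc : Coercive Δ γ) {W : (Tor M → ℝ) → ℝ} {B : ℝ} (hWm : Measurable W)
    (hWb : ∀ φ, |W φ| ≤ B) (t : ℝ) :
    Integrable (fun φ : Tor M → ℝ => Real.exp (-(φ ⬝ᵥ (Δ *ᵥ φ) / 2)) * Real.exp (t * W φ)) := by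
  have hgm : Measurable fun φ : Tor M → ℝ => Real.exp (t * W φ) := Real.measurable_exp.comp (hWm.const_mul t)
  refine (integrable_exp_neg_action M hγ hc).mul_bdd (c := Real.exp (|t| * B)) hgm.aestronglyMeasurable (Eventually.of_forall fun φ => ?_)
  rw [Real.norm_eq_abs, abs_of_pos (Real.exp_pos _)]
  refine Real.exp_le_exp.2 ?_
  calc t * W φ ≤ |t * W φ| := le_abs_self _
    _ = |t| * |W φ| := abs_mul _ _
    _ ≤ |t| * B := mul_le_mul_of_nonneg_left (hWb φ) (abs_nonneg _)

/-- The FULL-SPACE dressed Gaussian partition function is positive. [folklore] -/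
theorem dressedZ_full_pos {Δ : Matrix (Tor M) (Tor M) ℝ} {γ : ℝ} (hγ : 0 < γ) (hc : Coercive Δ γ) {W : (Tor M → ℝ) → ℝ} {B : ℝ} (hWm : Measurable W)
    (hWb : ∀ φ, |W φ| ≤ B) (t : ℝ) : 0 < ∫ φ : Tor M → ℝ, Real.exp (-(φ ⬝ᵥ (Δ *ᵥ φ) / 2)) * Real.exp (t * W φ) := by
  rw [integral_pos_iff_support_of_nonneg_ae (Eventually.of_forall fun φ => (integrand_pos M Δ W t φ).le) (integrable_dressed M hγ hc hWm hWb t)]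
  have hsupp : Function.support (fun φ : Tor M → ℝ => Real.exp (-(φ ⬝ᵥ (Δ *ᵥ φ) / 2)) * Real.exp (t * W φ)) = Set.univ :=
    Set.eq_univ_of_forall fun φ => (integrand_pos M Δ W t φ).ne'
  rw [hsupp]
  exact (YMDAG.N18.KingModelCauchy.volume_smallField_pos M one_pos).trans_le (measure_mono (Set.subset_univ _))

end Integrability

/-! ## §2 The large-field weight: coercivity + Gaussian scaling -/
section LargeField

/-- ON THE LARGE-FIELD CLASS the Boltzmann factor carries the small factor `e^{−γR²/4}`: if `R < |φ(x)|` for some `x` (`0 ≤ R`) and `γ(φ·φ) ≤ φ·Δφ`, then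
`e^{−φ·Δφ/2} ≤ e^{−γR²/4}·e^{−φ·Δφ/4}`. [folklore] -/
theorem exp_neg_action_le_of_large {Δ : Matrix (Tor M) (Tor M) ℝ} {γ R : ℝ} (hR : 0 ≤ R) (hc : Coercive Δ γ) (hγ : 0 ≤ γ) {φ : Tor M → ℝ} (hφ : ∃ x, R < |φ x|) :
    Real.exp (-(φ ⬝ᵥ (Δ *ᵥ φ) / 2)) ≤ Real.exp (-(γ * R ^ 2 / 4)) * Real.exp (-(φ ⬝ᵥ (Δ *ᵥ φ) / 4)) := by
  obtain ⟨x, hx⟩ := hφ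
  rw [← Real.exp_add]
  have h1 : γ * (φ ⬝ᵥ φ) ≤ φ ⬝ᵥ (Δ *ᵥ φ) := hc φ
  have h2 : φ x ^ 2 ≤ φ ⬝ᵥ φ := by
    rw [dotProduct_self_eq_sum_sq M φ]
    exact Finset.single_le_sum (fun y _ => sq_nonneg (φ y)) (Finset.mem_univ x)
  have h3 : R ^ 2 ≤ φ x ^ 2 := by rw [← sq_abs (φ x)]; exact pow_le_pow_left₀ hR hx.le 2
  exact Real.exp_le_exp.2 (by nlinarith)

/-- **GAUSSIAN SCALING** [folklore; Mathlib `Measure.integral_comp_smul`]: `∫ e^{−φ·Δφ/4} dφ = √2^{|Tor M|} · ∫ e^{−φ·Δφ/2} dφ` (substitute `φ = √2·ψ`). -/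
theorem integral_exp_neg_quarter_action (Δ : Matrix (Tor M) (Tor M) ℝ) :
    ∫ φ : Tor M → ℝ, Real.exp (-(φ ⬝ᵥ (Δ *ᵥ φ) / 4)) = Real.sqrt 2 ^ Fintype.card (Tor M) * ∫ φ : Tor M → ℝ, Real.exp (-(φ ⬝ᵥ (Δ *ᵥ φ) / 2)) := by
  have hs : Real.sqrt 2 ≠ 0 := (Real.sqrt_pos.2 (by norm_num)).ne'
  have hsq : (Real.sqrt 2)⁻¹ ^ 2 = 1 / 2 := by
    rw [inv_pow, Real.sq_sqrt (by norm_num : (0:ℝ) ≤ 2), one_div]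
  -- `e^{−φ·Δφ/4} = e^{−S((√2)⁻¹•φ)/2}`
  have hfun : (fun φ : Tor M → ℝ => Real.exp (-(φ ⬝ᵥ (Δ *ᵥ φ) / 4)))
      = fun φ => (fun ψ : Tor M → ℝ => Real.exp (-(ψ ⬝ᵥ (Δ *ᵥ ψ) / 2))) ((Real.sqrt 2)⁻¹ • φ) := by
    funext φ
    simp only
    rw [dotProduct_mulVec_smul M Δ, hsq]
    ring_nf
  rw [hfun, Measure.integral_comp_smul volume (fun ψ : Tor M → ℝ => Real.exp (-(ψ ⬝ᵥ (Δ *ᵥ ψ) / 2))) ((Real.sqrt 2)⁻¹)]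
  rw [Module.finrank_fintype_fun_eq_card, inv_pow, inv_inv, smul_eq_mul, abs_of_pos (pow_pos (Real.sqrt_pos.2 (by norm_num)) _)]

/-- **★★ THE LARGE-FIELD WEIGHT OF A KING GAUSSIAN CLASS** [folklore ∘ §1–§2]: for a coercive effective Laplacian (`γ(φ·φ) ≤ φ·Δφ`, `γ > 0`), a bounded measurable observable (`|W| ≤ B`) and a
radius `R ≥ 0`, the dressed weight of the LARGE-FIELD class is a small multiple of the total dressed weight:
`∫_{∃x, R<|φ x|} e^{−φ·Δφ/2}e^{tW} dφ ≤ (e^{2|t|B}·√2^{|Tor M|}·e^{−γR²/4}) · ∫ e^{−φ·Δφ/2}e^{tW} dφ`. -/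
theorem largeField_weight_le {Δ : Matrix (Tor M) (Tor M) ℝ} {γ : ℝ} (hγ : 0 < γ) (hc : Coercive Δ γ) {W : (Tor M → ℝ) → ℝ} {B : ℝ} (hWm : Measurable W)
    (hWb : ∀ φ, |W φ| ≤ B) (t : ℝ) {R : ℝ} (hR : 0 ≤ R) :
    ∫ φ in {φ : Tor M → ℝ | ∀ x, |φ x| ≤ R}ᶜ, Real.exp (-(φ ⬝ᵥ (Δ *ᵥ φ) / 2)) * Real.exp (t * W φ)
      ≤ (Real.exp (2 * (|t| * B)) * Real.sqrt 2 ^ Fintype.card (Tor M) * Real.exp (-(γ * R ^ 2 / 4))) *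
        ∫ φ : Tor M → ℝ, Real.exp (-(φ ⬝ᵥ (Δ *ᵥ φ) / 2)) * Real.exp (t * W φ) := by
  set S : (Tor M → ℝ) → ℝ := fun φ => φ ⬝ᵥ (Δ *ᵥ φ) with hS
  have hSm : Measurable S := measurable_dotProduct_mulVec M Δ
  have htW : ∀ φ, Real.exp (t * W φ) ≤ Real.exp (|t| * B) := fun φ => Real.exp_le_exp.2 <| by
    calc t * W φ ≤ |t * W φ| := le_abs_self _
      _ = |t| * |W φ| := abs_mul _ _
      _ ≤ |t| * B := mul_le_mul_of_nonneg_left (hWb φ) (abs_nonneg _)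
  have htW' : ∀ φ, Real.exp (-(|t| * B)) ≤ Real.exp (t * W φ) := fun φ => Real.exp_le_exp.2 <| by
    have : -(t * W φ) ≤ |t| * B := by
      calc -(t * W φ) ≤ |t * W φ| := neg_le_abs _
        _ = |t| * |W φ| := abs_mul _ _
        _ ≤ |t| * B := mul_le_mul_of_nonneg_left (hWb φ) (abs_nonneg _)
    linarith
  have hmeas : MeasurableSet ({φ : Tor M → ℝ | ∀ x, |φ x| ≤ R}ᶜ) := by
    rw [smallField_eq_Icc M R]
    exact measurableSet_Icc.compl
  have hlarge : ∀ φ ∈ ({φ : Tor M → ℝ | ∀ x, |φ x| ≤ R}ᶜ), ∃ x, R < |φ x| := fun φ hφ => by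
    simp only [Set.mem_compl_iff, Set.mem_setOf_eq, not_forall, not_le] at hφ
    exact hφ
  have hint := integrable_dressed M hγ hc hWm hWb t
  have hintS := integrable_exp_neg_action M hγ hc
  -- the quarter action is coercive with `γ/2`… we only need its integrability: it is `e^{−S(ψ)/2}` at `ψ = (√2)⁻¹φ`; use the scaling identity's integrand directly
  have hcq : Coercive ((1 / 2 : ℝ) • Δ) (γ / 2) := fun φ => by
    have := hc φ
    rw [Matrix.smul_mulVec, dotProduct_smul, smul_eq_mul]
    linarith
  have hintQ : Integrable (fun φ : Tor M → ℝ => Real.exp (-(φ ⬝ᵥ (Δ *ᵥ φ) / 4))) := by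
    have h := integrable_exp_neg_action M (half_pos hγ) hcq
    refine h.congr (Eventually.of_forall fun φ => ?_)
    simp only
    rw [Matrix.smul_mulVec, dotProduct_smul, smul_eq_mul]
    ring_nf
  -- step 1: strip the dressing and insert the large-field factor, pointwise on the bad class
  have step1 : ∫ φ in {φ : Tor M → ℝ | ∀ x, |φ x| ≤ R}ᶜ, Real.exp (-(φ ⬝ᵥ (Δ *ᵥ φ) / 2)) * Real.exp (t * W φ)
      ≤ ∫ φ in {φ : Tor M → ℝ | ∀ x, |φ x| ≤ R}ᶜ, Real.exp (|t| * B) * Real.exp (-(γ * R ^ 2 / 4)) * Real.exp (-(φ ⬝ᵥ (Δ *ᵥ φ) / 4)) := by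
    refine setIntegral_mono_on hint.integrableOn ((hintQ.const_mul _).integrableOn) hmeas fun φ hφ => ?_
    have hL := exp_neg_action_le_of_large M hR hc hγ.le (hlarge φ hφ)
    have h0 : 0 ≤ Real.exp (-(φ ⬝ᵥ (Δ *ᵥ φ) / 2)) := (Real.exp_pos _).le
    calc Real.exp (-(φ ⬝ᵥ (Δ *ᵥ φ) / 2)) * Real.exp (t * W φ) ≤ Real.exp (-(φ ⬝ᵥ (Δ *ᵥ φ) / 2)) * Real.exp (|t| * B) :=
          mul_le_mul_of_nonneg_left (htW φ) h0
      _ ≤ (Real.exp (-(γ * R ^ 2 / 4)) * Real.exp (-(φ ⬝ᵥ (Δ *ᵥ φ) / 4))) * Real.exp (|t| * B) :=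
          mul_le_mul_of_nonneg_right hL (Real.exp_pos _).le
      _ = Real.exp (|t| * B) * Real.exp (-(γ * R ^ 2 / 4)) * Real.exp (-(φ ⬝ᵥ (Δ *ᵥ φ) / 4)) := by ring
  -- step 2: enlarge the domain to the whole space and scale
  have step2 : ∫ φ in {φ : Tor M → ℝ | ∀ x, |φ x| ≤ R}ᶜ, Real.exp (|t| * B) * Real.exp (-(γ * R ^ 2 / 4)) * Real.exp (-(φ ⬝ᵥ (Δ *ᵥ φ) / 4))
      ≤ Real.exp (|t| * B) * Real.exp (-(γ * R ^ 2 / 4)) * (Real.sqrt 2 ^ Fintype.card (Tor M) * ∫ φ : Tor M → ℝ, Real.exp (-(φ ⬝ᵥ (Δ *ᵥ φ) / 2))) := by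
    rw [← integral_exp_neg_quarter_action M Δ, ← integral_const_mul]
    exact setIntegral_le_integral (hintQ.const_mul _) (Eventually.of_forall fun φ => by positivity)
  -- step 3: re-insert the dressing on the whole space
  have step3 : ∫ φ : Tor M → ℝ, Real.exp (-(φ ⬝ᵥ (Δ *ᵥ φ) / 2)) ≤ Real.exp (|t| * B) * ∫ φ : Tor M → ℝ, Real.exp (-(φ ⬝ᵥ (Δ *ᵥ φ) / 2)) * Real.exp (t * W φ) := by
    rw [← integral_const_mul]
    refine integral_mono hintS (hint.const_mul _) fun φ => ?_
    have h0 : 0 ≤ Real.exp (-(φ ⬝ᵥ (Δ *ᵥ φ) / 2)) := (Real.exp_pos _).le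
    calc Real.exp (-(φ ⬝ᵥ (Δ *ᵥ φ) / 2)) = Real.exp (|t| * B) * (Real.exp (-(φ ⬝ᵥ (Δ *ᵥ φ) / 2)) * Real.exp (-(|t| * B))) := by
          rw [mul_comm, mul_assoc, ← Real.exp_add, neg_add_cancel, Real.exp_zero, mul_one]
      _ ≤ Real.exp (|t| * B) * (Real.exp (-(φ ⬝ᵥ (Δ *ᵥ φ) / 2)) * Real.exp (t * W φ)) :=
          mul_le_mul_of_nonneg_left (mul_le_mul_of_nonneg_left (htW' φ) h0) (Real.exp_pos _).le
  have hZ0 : 0 ≤ ∫ φ : Tor M → ℝ, Real.exp (-(φ ⬝ᵥ (Δ *ᵥ φ) / 2)) * Real.exp (t * W φ) := integral_nonneg fun φ => (integrand_pos M Δ W t φ).le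
  have hpos1 : 0 ≤ Real.exp (|t| * B) * Real.exp (-(γ * R ^ 2 / 4)) * Real.sqrt 2 ^ Fintype.card (Tor M) := by positivity
  calc ∫ φ in {φ : Tor M → ℝ | ∀ x, |φ x| ≤ R}ᶜ, Real.exp (-(φ ⬝ᵥ (Δ *ᵥ φ) / 2)) * Real.exp (t * W φ)
      ≤ Real.exp (|t| * B) * Real.exp (-(γ * R ^ 2 / 4)) * (Real.sqrt 2 ^ Fintype.card (Tor M) * ∫ φ : Tor M → ℝ, Real.exp (-(φ ⬝ᵥ (Δ *ᵥ φ) / 2))) :=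
        step1.trans step2
    _ = (Real.exp (|t| * B) * Real.exp (-(γ * R ^ 2 / 4)) * Real.sqrt 2 ^ Fintype.card (Tor M)) * ∫ φ : Tor M → ℝ, Real.exp (-(φ ⬝ᵥ (Δ *ᵥ φ) / 2)) := by ring
    _ ≤ (Real.exp (|t| * B) * Real.exp (-(γ * R ^ 2 / 4)) * Real.sqrt 2 ^ Fintype.card (Tor M)) *
          (Real.exp (|t| * B) * ∫ φ : Tor M → ℝ, Real.exp (-(φ ⬝ᵥ (Δ *ᵥ φ) / 2)) * Real.exp (t * W φ)) := mul_le_mul_of_nonneg_left step3 hpos1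
    _ = (Real.exp (2 * (|t| * B)) * Real.sqrt 2 ^ Fintype.card (Tor M) * Real.exp (-(γ * R ^ 2 / 4))) *
          ∫ φ : Tor M → ℝ, Real.exp (-(φ ⬝ᵥ (Δ *ᵥ φ) / 2)) * Real.exp (t * W φ) := by
        rw [show (2 : ℝ) * (|t| * B) = |t| * B + |t| * B by ring, Real.exp_add]; ring

end LargeField

/-! ## §3 The two-class King tower: NE7b PRODUCED, `Core` on the small-field class, `HybridNE7`, and the Cauchy property for the FULL-SPACE partition functions -/
section TwoClass

/-- Sum over the two classes. [folklore] -/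
theorem sum_bool_eq (g : Bool → ℝ) : ∑ τ : Bool, g τ = g true + g false := by
  rw [Fintype.univ_bool, Finset.sum_insert (by simp), Finset.sum_singleton]

/-- The uniform coercivity constant of King's effective Laplacians along a run: `γ₀ = ((a(1 − L⁻²))⁻¹ + m⁻²)⁻¹ ≤ (a_k⁻¹ + m⁻²)⁻¹` (tree `aminL_le_aK`), so every
`Δ^{(k)}`, `k ≥ 1`, is `γ₀`-coercive (tree `Torus.effLaplacian_coercive`). [cite: King1986, (2.13) p.653, (4.33)–(4.35) p.674] -/
theorem effLaplacian_coercive_unif {a : ℝ} (ha : 0 < a) {L k : ℕ} [NeZero L] (hL : 2 ≤ L) (hk : 1 ≤ k) {m2 : ℝ} (hm : 0 < m2) :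
    Coercive (effLaplacian (L ^ k) M (aK a L k) (((L ^ k : ℕ) : ℝ) ^ 2) m2) (((aminL a L)⁻¹ + m2⁻¹)⁻¹) := by
  have hL1 : (1 : ℝ) < L := by exact_mod_cast hL
  have hNk : 1 ≤ L ^ k := Nat.one_le_pow k L (Nat.pos_of_ne_zero (NeZero.ne L))
  have hc := effLaplacian_coercive (L ^ k) M hNk (aK_pos ha hL1 hk) hm
  have hamin := aminL_pos ha hL
  have hak : 0 < aK a L k := aK_pos ha hL1 hk
  have hle : ((aminL a L)⁻¹ + m2⁻¹)⁻¹ ≤ ((aK a L k)⁻¹ + m2⁻¹)⁻¹ :=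
    inv_anti₀ (by positivity) (by gcongr; exact (aminL_le_aK ha hL hk).1)
  intro φ
  have h0 : 0 ≤ φ ⬝ᵥ φ := by rw [dotProduct_self_eq_sum_sq M φ]; exact Finset.sum_nonneg fun x _ => sq_nonneg _
  exact (mul_le_mul_of_nonneg_right hle h0).trans (hc φ)

/-- `γ₀ > 0`. [folklore] -/
theorem gamma0_pos {a : ℝ} (ha : 0 < a) {L : ℕ} (hL : 2 ≤ L) {m2 : ℝ} (hm : 0 < m2) : 0 < ((aminL a L)⁻¹ + m2⁻¹)⁻¹ := by
  have := aminL_pos ha hL; positivity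

variable {l₀ vol B : ℝ} {W : (Tor M → ℝ) → ℝ} {R : ℕ → ℝ} {Z : ℕ → ℝ → ℝ}

/-- **★★ NE7b PRODUCED FOR KING'S GAUSSIAN EFFECTIVE MEASURES** [folklore ∘ §2]: per run length `K`, class `false` = the small-field box `|φ(x)| ≤ R_K`, class `true` = its complement
(the bad class); run A = `Δ^{(K+1)}`, run B = `Δ^{(K+2)}`, both dressed by `e^{tW}` and read on the SAME two pieces.  If the weights `W_K := e^{2l₀B}·√2^{|Tor M|}·e^{−γ₀R_K²/4}` are `< 1`
and summable, then `T4WeightBudget.RelWeightBound l₀ univ A B {true} W` — the binder N20 consumes by name, inhabited with a PRODUCED weight. -/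
theorem relWeightBound_kingTwoClass {a : ℝ} (ha : 0 < a) {L : ℕ} [NeZero L] (hL : 2 ≤ L) {m2 : ℝ} (hm : 0 < m2) (hWm : Measurable W) (hWb : ∀ φ, |W φ| ≤ B)
    (hR : ∀ K, 0 ≤ R K)
    (hW1 : ∀ K, Real.exp (2 * (l₀ * B)) * Real.sqrt 2 ^ Fintype.card (Tor M) * Real.exp (-(((aminL a L)⁻¹ + m2⁻¹)⁻¹ * R K ^ 2 / 4)) < 1)
    (hWs : Summable fun K => Real.exp (2 * (l₀ * B)) * Real.sqrt 2 ^ Fintype.card (Tor M) * Real.exp (-(((aminL a L)⁻¹ + m2⁻¹)⁻¹ * R K ^ 2 / 4))) :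
    RelWeightBound l₀ (fun _ => (Finset.univ : Finset Bool))
      (fun K t τ => ∫ φ in (bif τ then {φ : Tor M → ℝ | ∀ x, |φ x| ≤ R K}ᶜ else {φ : Tor M → ℝ | ∀ x, |φ x| ≤ R K}),
        Real.exp (-(φ ⬝ᵥ (effLaplacian (L ^ (K + 1)) M (aK a L (K + 1)) (((L ^ (K + 1) : ℕ) : ℝ) ^ 2) m2 *ᵥ φ) / 2)) * Real.exp (t * W φ))
      (fun K t τ => ∫ φ in (bif τ then {φ : Tor M → ℝ | ∀ x, |φ x| ≤ R K}ᶜ else {φ : Tor M → ℝ | ∀ x, |φ x| ≤ R K}),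
        Real.exp (-(φ ⬝ᵥ (effLaplacian (L ^ (K + 1 + 1)) M (aK a L (K + 1 + 1)) (((L ^ (K + 1 + 1) : ℕ) : ℝ) ^ 2) m2 *ᵥ φ) / 2)) * Real.exp (t * W φ))
      (fun _ _ => ({true} : Finset Bool))
      fun K => Real.exp (2 * (l₀ * B)) * Real.sqrt 2 ^ Fintype.card (Tor M) * Real.exp (-(((aminL a L)⁻¹ + m2⁻¹)⁻¹ * R K ^ 2 / 4)) := by
  have hγ := gamma0_pos ha hL hm
  -- the two weight clauses, for any admissible run length `k ≥ 1`
  have key : ∀ (k : ℕ), 1 ≤ k → ∀ (K : ℕ) (t : ℝ), |t| ≤ l₀ →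
      ∫ φ in {φ : Tor M → ℝ | ∀ x, |φ x| ≤ R K}ᶜ, Real.exp (-(φ ⬝ᵥ (effLaplacian (L ^ k) M (aK a L k) (((L ^ k : ℕ) : ℝ) ^ 2) m2 *ᵥ φ) / 2)) * Real.exp (t * W φ)
        ≤ (Real.exp (2 * (l₀ * B)) * Real.sqrt 2 ^ Fintype.card (Tor M) * Real.exp (-(((aminL a L)⁻¹ + m2⁻¹)⁻¹ * R K ^ 2 / 4))) *
          ∑ τ : Bool, ∫ φ in (bif τ then {φ : Tor M → ℝ | ∀ x, |φ x| ≤ R K}ᶜ else {φ : Tor M → ℝ | ∀ x, |φ x| ≤ R K}),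
            Real.exp (-(φ ⬝ᵥ (effLaplacian (L ^ k) M (aK a L k) (((L ^ k : ℕ) : ℝ) ^ 2) m2 *ᵥ φ) / 2)) * Real.exp (t * W φ) := by
    intro k hk K t ht
    have hc := effLaplacian_coercive_unif M ha hL hk hm
    have hmeas : MeasurableSet {φ : Tor M → ℝ | ∀ x, |φ x| ≤ R K} := by rw [smallField_eq_Icc M (R K)]; exact measurableSet_Icc
    have hint := integrable_dressed M hγ hc hWm hWb t
    have hw := largeField_weight_le M hγ hc hWm hWb t (hR K)
    have hB0 : 0 ≤ B := by
      obtain ⟨φ⟩ : Nonempty (Tor M → ℝ) := ⟨fun _ => 0⟩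
      exact (abs_nonneg _).trans (hWb φ)
    have hexp : Real.exp (2 * (|t| * B)) ≤ Real.exp (2 * (l₀ * B)) := Real.exp_le_exp.2 (by nlinarith)
    have hC : Real.exp (2 * (|t| * B)) * Real.sqrt 2 ^ Fintype.card (Tor M) * Real.exp (-(((aminL a L)⁻¹ + m2⁻¹)⁻¹ * R K ^ 2 / 4))
        ≤ Real.exp (2 * (l₀ * B)) * Real.sqrt 2 ^ Fintype.card (Tor M) * Real.exp (-(((aminL a L)⁻¹ + m2⁻¹)⁻¹ * R K ^ 2 / 4)) :=
      mul_le_mul_of_nonneg_right (mul_le_mul_of_nonneg_right hexp (by positivity)) (Real.exp_pos _).le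
    set f : (Tor M → ℝ) → ℝ := fun φ =>
      Real.exp (-(φ ⬝ᵥ (effLaplacian (L ^ k) M (aK a L k) (((L ^ k : ℕ) : ℝ) ^ 2) m2 *ᵥ φ) / 2)) * Real.exp (t * W φ) with hf
    have hZ0 : 0 ≤ ∫ φ, f φ := integral_nonneg fun φ => (integrand_pos M _ W t φ).le
    rw [sum_bool_eq, cond_true, cond_false]
    calc ∫ φ in {φ : Tor M → ℝ | ∀ x, |φ x| ≤ R K}ᶜ, f φ
        ≤ (Real.exp (2 * (|t| * B)) * Real.sqrt 2 ^ Fintype.card (Tor M) * Real.exp (-(((aminL a L)⁻¹ + m2⁻¹)⁻¹ * R K ^ 2 / 4))) * ∫ φ, f φ := hw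
      _ ≤ (Real.exp (2 * (l₀ * B)) * Real.sqrt 2 ^ Fintype.card (Tor M) * Real.exp (-(((aminL a L)⁻¹ + m2⁻¹)⁻¹ * R K ^ 2 / 4))) * ∫ φ, f φ :=
        mul_le_mul_of_nonneg_right hC hZ0
      _ = (Real.exp (2 * (l₀ * B)) * Real.sqrt 2 ^ Fintype.card (Tor M) * Real.exp (-(((aminL a L)⁻¹ + m2⁻¹)⁻¹ * R K ^ 2 / 4))) *
            ((∫ φ in {φ : Tor M → ℝ | ∀ x, |φ x| ≤ R K}ᶜ, f φ) + ∫ φ in {φ : Tor M → ℝ | ∀ x, |φ x| ≤ R K}, f φ) := by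
        rw [← integral_add_compl hmeas hint]; ring
  refine ⟨fun _ _ _ => Finset.subset_univ _, fun K => by positivity, hW1, hWs, fun K t ht => ?_, fun K t ht => ?_⟩
  · rw [Finset.sum_singleton, cond_true]
    exact key (K + 1) (by omega) K t ht
  · rw [Finset.sum_singleton, cond_true]
    exact key (K + 1 + 1) (by omega) K t ht

/-- **★ `Core` ON THE SMALL-FIELD CLASS OF THE TWO-CLASS TOWER** [folklore ∘ `KingModelDensTorus` + n19-d `core_dressed_of_vacuumDens`]: with the bad class `{true}` excluded, the dressed class
partition functions of the two runs are sandwiched with radius `θ_{K+1}·a·R_K²·|Tor M|/2` (`abs_action_sub_le_torus_of_eq`, run B = run A one level up), so `Core l₀ vol univ {true} A B δ`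
for any `vol·δ_K ≥ θ_{K+1}·a·R_K²·|Tor M|/2`. -/
theorem core_kingTwoClass {a : ℝ} (ha : 0 < a) {L : ℕ} [NeZero L] (hL : 2 ≤ L) {m2 : ℝ} (hm : 0 < m2) (hB : 0 ≤ B) (hWm : Measurable W) (hWb : ∀ φ, |W φ| ≤ B)
    {δ : ℕ → ℝ} (hδ : ∀ K, thetaK a L (K + 1) 1 * a * (R K ^ 2 * Fintype.card (Tor M)) / 2 ≤ vol * δ K) :
    Core l₀ vol (fun _ => (Finset.univ : Finset Bool)) (fun _ _ => ({true} : Finset Bool))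
      (fun K t τ => ∫ φ in (bif τ then {φ : Tor M → ℝ | ∀ x, |φ x| ≤ R K}ᶜ else {φ : Tor M → ℝ | ∀ x, |φ x| ≤ R K}),
        Real.exp (-(φ ⬝ᵥ (effLaplacian (L ^ (K + 1)) M (aK a L (K + 1)) (((L ^ (K + 1) : ℕ) : ℝ) ^ 2) m2 *ᵥ φ) / 2)) * Real.exp (t * W φ))
      (fun K t τ => ∫ φ in (bif τ then {φ : Tor M → ℝ | ∀ x, |φ x| ≤ R K}ᶜ else {φ : Tor M → ℝ | ∀ x, |φ x| ≤ R K}),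
        Real.exp (-(φ ⬝ᵥ (effLaplacian (L ^ (K + 1 + 1)) M (aK a L (K + 1 + 1)) (((L ^ (K + 1 + 1) : ℕ) : ℝ) ^ 2) m2 *ᵥ φ) / 2)) * Real.exp (t * W φ)) δ := by
  have hγ := gamma0_pos ha hL hm
  have hmeasA : ∀ K, Measurable fun φ : Tor M → ℝ =>
      Real.exp (-(φ ⬝ᵥ (effLaplacian (L ^ (K + 1)) M (aK a L (K + 1)) (((L ^ (K + 1) : ℕ) : ℝ) ^ 2) m2 *ᵥ φ) / 2)) := fun K =>
    Real.measurable_exp.comp ((measurable_dotProduct_mulVec M _).div_const 2).neg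
  have hmeasB : ∀ K, Measurable fun φ : Tor M → ℝ =>
      Real.exp (-(φ ⬝ᵥ (effLaplacian (L ^ (K + 1 + 1)) M (aK a L (K + 1 + 1)) (((L ^ (K + 1 + 1) : ℕ) : ℝ) ^ 2) m2 *ᵥ φ) / 2)) := fun K =>
    Real.measurable_exp.comp ((measurable_dotProduct_mulVec M _).div_const 2).neg
  refine core_dressed_of_vacuumDens (Ω := fun _ => Tor M → ℝ)
    (μ := fun K τ => (volume : Measure (Tor M → ℝ)).restrict (bif τ then {φ : Tor M → ℝ | ∀ x, |φ x| ≤ R K}ᶜ else {φ : Tor M → ℝ | ∀ x, |φ x| ≤ R K}))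
    (W := fun _ => W)
    (fA := fun K _ φ => Real.exp (-(φ ⬝ᵥ (effLaplacian (L ^ (K + 1)) M (aK a L (K + 1)) (((L ^ (K + 1) : ℕ) : ℝ) ^ 2) m2 *ᵥ φ) / 2)))
    (fB := fun K _ φ => Real.exp (-(φ ⬝ᵥ (effLaplacian (L ^ (K + 1 + 1)) M (aK a L (K + 1 + 1)) (((L ^ (K + 1 + 1) : ℕ) : ℝ) ^ 2) m2 *ᵥ φ) / 2)))
    (r := fun K => thetaK a L (K + 1) 1 * a * (R K ^ 2 * Fintype.card (Tor M)) / 2)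
    hB (fun _ => hWm) (fun _ => hWb) (fun K _ => hmeasA K) (fun K _ φ => (Real.exp_pos _).le)
    (fun K τ _ => ((integrable_exp_neg_action M hγ (effLaplacian_coercive_unif M ha hL (by omega) hm)).mono_measure Measure.restrict_le_self))
    (fun K _ => hmeasB K) (fun K _ φ => (Real.exp_pos _).le)
    (fun K τ _ => ((integrable_exp_neg_action M hγ (effLaplacian_coercive_unif M ha hL (by omega) hm)).mono_measure Measure.restrict_le_self))
    (fun K t τ _ => rfl) (fun K t τ _ => rfl) (fun K => ⟨0, fun t ht τ hτ => ?_⟩) hδ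
  -- the good class is `τ = false`: the small-field box
  have hτ' : τ = false := by
    rcases τ with _ | _
    · rfl
    · exact absurd hτ (by simp)
  subst hτ'
  simp only [cond_false]
  refine (ae_dotProduct_le_smallField M (R K)).mono fun φ hφ => exp_neg_sandwich_of_abs_sub_le ?_
  refine (abs_action_sub_le_torus_of_eq M ha hL (k := K + 1) (n := 1) (by omega) le_rfl hm (L ^ (K + 1 + 1)) (by rw [pow_one, pow_succ, mul_comm]) (K + 1 + 1)
    rfl φ).trans ?_
  have : thetaK a L (K + 1) 1 * a * (φ ⬝ᵥ φ) ≤ thetaK a L (K + 1) 1 * a * (R K ^ 2 * Fintype.card (Tor M)) :=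
    mul_le_mul_of_nonneg_left hφ (mul_nonneg (kingTheta_nonneg ha hL (by omega) le_rfl) ha.le)
  linarith

/-- **★★ THE SPINE's NE7 ASSEMBLY WITH A GENUINE LARGE-FIELD CLASS, INHABITED BY KING'S GAUSSIAN MODEL** [folklore ∘ §3 + `T4MatchingAssembly.hybridNE7_noShell`]: `HybridNE7 l₀ vol univ
A B {true} W 0 0 0 δ` with the PRODUCED weight `W_K = e^{2l₀B}√2^{|Tor M|}e^{−γ₀R_K²/4}` and the core radius `δ_K = θ_{K+1}·a·R_K²|Tor M|/(2vol)`, given the two rate conditions on `R`. -/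
theorem hybridNE7_kingTwoClass {a : ℝ} (ha : 0 < a) {L : ℕ} [NeZero L] (hL : 2 ≤ L) {m2 : ℝ} (hm : 0 < m2) (hvol : 0 < vol) (hB : 0 ≤ B) (hWm : Measurable W)
    (hWb : ∀ φ, |W φ| ≤ B) (hR : ∀ K, 0 ≤ R K)
    (hW1 : ∀ K, Real.exp (2 * (l₀ * B)) * Real.sqrt 2 ^ Fintype.card (Tor M) * Real.exp (-(((aminL a L)⁻¹ + m2⁻¹)⁻¹ * R K ^ 2 / 4)) < 1)
    (hWs : Summable fun K => Real.exp (2 * (l₀ * B)) * Real.sqrt 2 ^ Fintype.card (Tor M) * Real.exp (-(((aminL a L)⁻¹ + m2⁻¹)⁻¹ * R K ^ 2 / 4)))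
    (hrs : Summable fun K => thetaK a L (K + 1) 1 * a * (R K ^ 2 * Fintype.card (Tor M)) / 2 / vol) :
    HybridNE7 l₀ vol (fun _ => (Finset.univ : Finset Bool))
      (fun K t τ => ∫ φ in (bif τ then {φ : Tor M → ℝ | ∀ x, |φ x| ≤ R K}ᶜ else {φ : Tor M → ℝ | ∀ x, |φ x| ≤ R K}),
        Real.exp (-(φ ⬝ᵥ (effLaplacian (L ^ (K + 1)) M (aK a L (K + 1)) (((L ^ (K + 1) : ℕ) : ℝ) ^ 2) m2 *ᵥ φ) / 2)) * Real.exp (t * W φ))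
      (fun K t τ => ∫ φ in (bif τ then {φ : Tor M → ℝ | ∀ x, |φ x| ≤ R K}ᶜ else {φ : Tor M → ℝ | ∀ x, |φ x| ≤ R K}),
        Real.exp (-(φ ⬝ᵥ (effLaplacian (L ^ (K + 1 + 1)) M (aK a L (K + 1 + 1)) (((L ^ (K + 1 + 1) : ℕ) : ℝ) ^ 2) m2 *ᵥ φ) / 2)) * Real.exp (t * W φ))
      (fun _ _ => ({true} : Finset Bool))
      (fun K => Real.exp (2 * (l₀ * B)) * Real.sqrt 2 ^ Fintype.card (Tor M) * Real.exp (-(((aminL a L)⁻¹ + m2⁻¹)⁻¹ * R K ^ 2 / 4)))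
      (fun _ _ _ => 0) (fun _ _ _ => 0) (fun _ => 0) fun K => thetaK a L (K + 1) 1 * a * (R K ^ 2 * Fintype.card (Tor M)) / 2 / vol :=
  hybridNE7_noShell (relWeightBound_kingTwoClass M ha hL hm hWm hWb hR hW1 hWs)
    (fun K t _ τ _ => integral_nonneg fun φ => (integrand_pos M _ W t φ).le) (fun K t _ τ _ => integral_nonneg fun φ => (integrand_pos M _ W t φ).le) hrs
    (core_kingTwoClass M ha hL hm hB hWm hWb fun K => le_of_eq (by field_simp))

/-- **★★★ THE CAUCHY PROPERTY OF THE GENERATING FUNCTIONS OF KING'S FULL-SPACE GAUSSIAN EFFECTIVE MEASURES** [folklore ∘ `hybridNE7_kingTwoClass` + `HybridNE7.cauchy`]: with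
`Z K t = ∫ exp(−½φ·Δ^{(K+1)}φ)·e^{tW φ} dφ` over the WHOLE unit-lattice field space (no small-field restriction), for `vol > 0`, `l₀ ≥ 0`, a bounded measurable `W` and radii `R` meeting the
two rate conditions: NE7 `MatchingModConstants vol l₀ δ♭ Z` with the summable remainder `δ♭ = hybridDelta vol δ (W + 0)`, `CauchySeq (K ↦ genFun Z K t)` for every `|t| ≤ l₀`, and uniform
convergence of the generating functions on the window. -/
theorem cauchy_genFun_kingTwoClass {a : ℝ} (ha : 0 < a) {L : ℕ} [NeZero L] (hL : 2 ≤ L) {m2 : ℝ} (hm : 0 < m2) (hvol : 0 < vol) (hl₀ : 0 ≤ l₀) (hB : 0 ≤ B)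
    (hWm : Measurable W) (hWb : ∀ φ, |W φ| ≤ B) (hR : ∀ K, 0 ≤ R K)
    (hW1 : ∀ K, Real.exp (2 * (l₀ * B)) * Real.sqrt 2 ^ Fintype.card (Tor M) * Real.exp (-(((aminL a L)⁻¹ + m2⁻¹)⁻¹ * R K ^ 2 / 4)) < 1)
    (hWs : Summable fun K => Real.exp (2 * (l₀ * B)) * Real.sqrt 2 ^ Fintype.card (Tor M) * Real.exp (-(((aminL a L)⁻¹ + m2⁻¹)⁻¹ * R K ^ 2 / 4)))
    (hrs : Summable fun K => thetaK a L (K + 1) 1 * a * (R K ^ 2 * Fintype.card (Tor M)) / 2 / vol)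
    (hZ : ∀ K (t : ℝ), Z K t = ∫ φ : Tor M → ℝ, Real.exp (-(φ ⬝ᵥ (effLaplacian (L ^ (K + 1)) M (aK a L (K + 1)) (((L ^ (K + 1) : ℕ) : ℝ) ^ 2) m2 *ᵥ φ) / 2)) * Real.exp (t * W φ)) :
    MatchingModConstants vol l₀
        (hybridDelta vol (fun K => thetaK a L (K + 1) 1 * a * (R K ^ 2 * Fintype.card (Tor M)) / 2 / vol)
          fun K => Real.exp (2 * (l₀ * B)) * Real.sqrt 2 ^ Fintype.card (Tor M) * Real.exp (-(((aminL a L)⁻¹ + m2⁻¹)⁻¹ * R K ^ 2 / 4)) + 0) Z ∧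
      Summable (hybridDelta vol (fun K => thetaK a L (K + 1) 1 * a * (R K ^ 2 * Fintype.card (Tor M)) / 2 / vol)
          fun K => Real.exp (2 * (l₀ * B)) * Real.sqrt 2 ^ Fintype.card (Tor M) * Real.exp (-(((aminL a L)⁻¹ + m2⁻¹)⁻¹ * R K ^ 2 / 4)) + 0) ∧
      (∀ t : ℝ, |t| ≤ l₀ → CauchySeq fun K => genFun Z K t) ∧
      TendstoUniformlyOn (fun K t => genFun Z K t) (genFunLim Z) atTop {t | |t| ≤ l₀} := by
  have hγ := gamma0_pos ha hL hm
  -- the dictionary: both runs' class sums are the FULL-SPACE dressed partition functions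
  have hsum : ∀ (k : ℕ), 1 ≤ k → ∀ (K : ℕ) (t : ℝ),
      ∑ τ : Bool, ∫ φ in (bif τ then {φ : Tor M → ℝ | ∀ x, |φ x| ≤ R K}ᶜ else {φ : Tor M → ℝ | ∀ x, |φ x| ≤ R K}),
          Real.exp (-(φ ⬝ᵥ (effLaplacian (L ^ k) M (aK a L k) (((L ^ k : ℕ) : ℝ) ^ 2) m2 *ᵥ φ) / 2)) * Real.exp (t * W φ)
        = ∫ φ : Tor M → ℝ, Real.exp (-(φ ⬝ᵥ (effLaplacian (L ^ k) M (aK a L k) (((L ^ k : ℕ) : ℝ) ^ 2) m2 *ᵥ φ) / 2)) * Real.exp (t * W φ) := by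
    intro k hk K t
    have hmeas : MeasurableSet {φ : Tor M → ℝ | ∀ x, |φ x| ≤ R K} := by rw [smallField_eq_Icc M (R K)]; exact measurableSet_Icc
    rw [sum_bool_eq, cond_true, cond_false, ← integral_add_compl hmeas (integrable_dressed M hγ (effLaplacian_coercive_unif M ha hL hk hm) hWm hWb t)]
    ring
  exact (hybridNE7_kingTwoClass M ha hL hm hvol hB hWm hWb hR hW1 hWs hrs).cauchy (Z := Z) hvol hl₀
    (fun K t _ => by rw [hsum (K + 1) (by omega) K t, hZ K t])
    (fun K t _ => by rw [hsum (K + 1 + 1) (by omega) K t, hZ (K + 1) t])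
    (fun K t _ => by
      rw [hsum (K + 1) (by omega) K t]
      exact dressedZ_full_pos M hγ (effLaplacian_coercive_unif M ha hL (by omega) hm) hWm hWb t)

end TwoClass

end YMDAG.N18.KingModelLargeField

end
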